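import Literature.Analysis.FluidPDE.NSGalerkinSteadyScheme
import HarnessLib

/-!
# The Hopf–Galerkin scheme on `𝕋²` with the enstrophy inequality
  (Foias–Manley–Rosa–Temam 2001, App. II.A (A.65)–(A.67) at the Galerkin level,
  time-dependent `L²ₜₓ` force)

Trunk: FluidKinetic (`Literature/Analysis/FluidPDE`). The tree proves Hopf's existence theorem on
the torus by the Fourier–Galerkin method (`NSHopfGalerkinExistence`: smoothed forces
`F n → f` in `L²((0,T) × T^d)`, the Galerkin ODE `ċ = V(g, c)` and its energy identity;
`NSHopfLimit`, `NSHopfGalerkinLimit`: the limit field is a global Leray–Hopf solution) and, on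
`𝕋²`, the *enstrophy identity* of the same Galerkin system (`NSGalerkinEnstrophy2D`,
`NS.galerkin_enstrophy_identity_fin_two`:
`½‖∇u(t)‖₂² + ν∫ₛᵗ‖Δu‖₂² = ½‖∇u(s)‖₂² - ∫ₛᵗ∫⟪G, Δu⟫`, the cubic term dropping out by the
orthogonality (A.62) `b(u,u,Au) = 0`, Foias–Manley–Rosa–Temam 2001, Remark 7.1, PDF p. 73, and
App. II.A (A.65), PDF p. 118). This file runs that identity along the Hopf–Galerkin scheme with
a *time-dependent* square-integrable force and closes it by Young's inequality, which is the
step printed between (A.65) and (A.66)–(A.67) (op. cit. p. 118: "This provides us with an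
estimate for the enstrophy which is similar to that for the kinetic energy"):

* `NS.exists_hopfGalerkinScheme_coeffs` (every dimension) — the Hopf–Galerkin scheme of
  `NS.exists_isHopfGalerkinScheme` with its coefficient curves exported: smooth real force
  coefficients `g n` (`F n = realTrigPoly (freqBall n) (g n ·) → f` in `L²ₜₓ`) and the global
  solutions `α n` of the Galerkin ODE (`U n = realTrigPoly (freqBall n) (α n ·)`, datum the
  Fourier truncation of `u₀`), so that further identities can be run on them (as
  `NS.exists_steady_galerkin_scheme` does for steady forces);
* `NS.re_inner_smul_le_young` — Young's inequality for one Fourier mode of the force term;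
* `NS.galerkin_enstrophy_ineq_fin_two` — **the Galerkin enstrophy inequality on `𝕋²`**: for
  `ν > 0` and `0 ≤ s ≤ t`,
  `‖∇u(t)‖₂² + ν∫ₛᵗ‖Δu‖₂² ≤ ‖∇u(s)‖₂² + ν⁻¹∫ₛᵗ‖G‖₂²` in `[0, ∞]`
  (identity (A.65) integrated, `-(G, Δu) ≤ ½ν|Δu|² + ½ν⁻¹|G|²` mode by mode, Parseval);
* `NS.exists_hopfGalerkinScheme_enstrophy_fin_two` — on `𝕋²` every datum/force as in Hopf's
  theorem admits a Hopf–Galerkin scheme all of whose members satisfy the enstrophy inequality,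
  with `‖∇U n(0)‖₂ ≤ ‖∇u₀‖₂` (`U n 0 = P_n u₀`).

The passage to the limit (Fatou in the frequencies and in time, the `L²ₜₓ` convergence of the
smoothed forces) and the discharge of `fmrt_strong_existence_torus2` (`NSStrongSolutions2D`) are
in `NSStrongSolutions2DProofs`.

## Mathlib / tree search

Reused: `NS.exists_galerkin_solution`, `NS.galerkin_test_identity`, `NS.galerkin_energy_identity`,
`Torus.exists_smooth_realTrigPoly_approx` (`NSHopfGalerkinExistence`);
`NS.galerkin_enstrophy_identity_fin_two`, `NS.integral_inner_realTrigPoly_laplacian_eq_sum`,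
`NS.lintegral_eLaplacianNormSq_galerkin_lt_top` (`NSGalerkinEnstrophy2D`);
`NS.intervalIntegral_norm_sq_eq_toReal` (`NSHopfLimit`); `Torus.eGradNormSq_fourierTruncate_le`
(`StatisticalSolutionEnergyEq`); Mathlib's `re_inner_le_norm`,
`intervalIntegral.integral_mono_on`. Nothing on enstrophy inequalities of the Hopf scheme with
time-dependent forces existed (searched `galerkin_enstrophy_ineq`, `exists_hopfGalerkinScheme`).

## References

* C. Foias, O. Manley, R. Rosa, R. Temam, *Navier–Stokes Equations and Turbulence*, CUP 2001,
  Ch. II Thm. 7.4 (PDF p. 72), Remark 7.1 (PDF p. 73), App. II.A (A.62), (A.65)–(A.67)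
  (PDF p. 118). [FoiasManleyRosaTemam2001]
* J. C. Robinson, J. L. Rodrigo, W. Sadowski, *The three-dimensional Navier–Stokes equations*,
  CUP 2016, Thm. 4.4 Steps 1–2. [RobinsonRodrigoSadowski2016]
* P. Constantin, C. Foias, *Navier–Stokes Equations*, Chicago 1988, Ch. 8, (8.3)–(8.9).
-/

open MeasureTheory Set Filter UnitAddTorus
open scoped ENNReal NNReal InnerProductSpace Topology

noncomputable section

namespace Literature.Analysis.FluidPDE

section NS

open FunctionSpaces.Torus Torus

variable {d : Type*} [Fintype d] [DecidableEq d]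

/-! ### The Hopf–Galerkin scheme with its coefficient curves (every dimension) -/

section Coeffs

/-- **The Hopf–Galerkin scheme with its coefficient ODEs exported** (Robinson–Rodrigo–Sadowski
2016, Thm. 4.4, Steps 1–2; Constantin–Foias 1988, Ch. 8, (8.3)–(8.9), p. 43; Hopf 1951, §§2–3).
Let `ν > 0`, `u₀ ∈ L²(T^d; ℝ^d)` weakly divergence free, and `f` space–time measurable with
`∫₀ᵀ ∫ ‖f‖² < ∞` for every `T > 0`. Then there are smooth, real force coefficient curves
`g n : ℝ → (freqBall n → ℂ^d)` with `realTrigPoly (freqBall n) (g n ·) → f` in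
`L²((0,T) × T^d)` (`Torus.exists_smooth_realTrigPoly_approx`) and global solutions `α n` of the
`n`-th Galerkin ODE driven by `g n` from the datum `(û₀(k))_{|k| ≤ n}`
(`NS.exists_galerkin_solution`) — continuous on `[0, ∞)`, valued in the Galerkin phase space,
solving the ODE on every `[0, T]` — such that
`(id, realTrigPoly (freqBall n) (g n ·), realTrigPoly (freqBall n) (α n ·))` is a Hopf–Galerkin
scheme for `(ν, f, u₀)` (`NS.IsHopfGalerkinScheme`; the proof of `NS.exists_isHopfGalerkinScheme`
with the witnesses kept). [cite: RobinsonRodrigoSadowski2016, Thm. 4.4 Steps 1–2] -/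
theorem exists_hopfGalerkinScheme_coeffs (ν : ℝ) (hν : 0 < ν)
    (u₀ : UnitAddTorus d → EuclideanSpace ℝ d) (hu₀ : MemLp u₀ 2 volume)
    (hdiv : FunctionSpaces.Torus.IsWeaklyDivFree u₀) (f : ℝ → UnitAddTorus d → EuclideanSpace ℝ d)
    (hf : AEStronglyMeasurable (stLift f) (volume.restrict (Ioi 0 ×ˢ univ)))
    (hf₂ : ∀ T, 0 < T → ∫⁻ t in Ioo 0 T, ∫⁻ x, ‖f t x‖ₑ ^ 2 < ⊤) :
    ∃ (g α : (n : ℕ) → ℝ → ↥(freqBall (d := d) n) → EuclideanSpace ℂ d),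
      (∀ n, Continuous (g n)) ∧ (∀ n t, IsRealCoeff (g n t)) ∧
      (∀ n, α n 0 = fun k : ↥(freqBall (d := d) n) =>
        mFourierCoeff (FunctionSpaces.EuclideanSpace.complexify ∘ u₀) (k : d → ℤ)) ∧
      (∀ n t, α n t ∈ galerkinSubspace (freqBall n)) ∧
      (∀ n, ContinuousOn (α n) (Ici 0)) ∧
      (∀ n T, ∀ t ∈ Icc 0 T, HasDerivWithinAt (α n)
        (galerkinRHS (freqBall n) ν (g n t) (α n t)) (Icc 0 T) t) ∧
      IsHopfGalerkinScheme ν f u₀ id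
        (fun n t => realTrigPoly (freqBall n) (coeffExt (freqBall n) (g n t)))
        (fun n t => realTrigPoly (freqBall n) (coeffExt (freqBall n) (α n t))) := by
  -- the smoothed forces
  obtain ⟨g, hg_smooth, hg_real, hg_tend⟩ := exists_smooth_realTrigPoly_approx hf hf₂
  have hg_cont : ∀ n, Continuous (g n) := fun n => (hg_smooth n).continuous
  have hS : ∀ n : ℕ, ∀ k ∈ freqBall (d := d) n, -k ∈ freqBall n := fun n =>
    neg_mem_freqBall_of_mem
  -- the data of the Galerkin systems: `(û₀(k))_{|k| ≤ n}`
  set c₀ : (n : ℕ) → ↥(freqBall (d := d) n) → EuclideanSpace ℂ d :=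
    fun n k => mFourierCoeff (FunctionSpaces.EuclideanSpace.complexify ∘ u₀) k with hc₀_def
  have hc₀ : ∀ n, c₀ n ∈ galerkinSubspace (freqBall (d := d) n) := fun n =>
    ⟨isRealCoeff_mFourierCoeff (hu₀.integrable one_le_two),
      isSolenoidalCoeff_restrict (hdiv.isTransversal_mFourierCoeff hu₀ (freqBall n))⟩
  -- the global Galerkin solutions
  have hsol : ∀ n : ℕ, ∃ α : ℝ → ↥(freqBall (d := d) n) → EuclideanSpace ℂ d,
      α 0 = c₀ n ∧ (∀ t, α t ∈ galerkinSubspace (freqBall n)) ∧ ContinuousOn α (Ici 0) ∧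
      ∀ T, ∀ t ∈ Icc 0 T, HasDerivWithinAt α (galerkinRHS (freqBall n) ν (g n t) (α t))
        (Icc 0 T) t := fun n =>
    exists_galerkin_solution ν hν.le (hS n) (hg_cont n) (hg_real n) (hc₀ n)
  choose α hα0 hαmem hαcont hαderiv using hsol
  refine ⟨g, α, hg_cont, hg_real, hα0, hαmem, hαcont, hαderiv, ?_⟩
  -- the datum is the Fourier truncation
  have hU0 : ∀ n, realTrigPoly (freqBall n) (coeffExt (freqBall n) (α n 0)) =
      fourierTruncate n u₀ := by
    intro n
    rw [hα0 n, fourierTruncate_eq]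
    exact realTrigPoly_coeffExt_restrict _
  -- band-limitation of Galerkin modes in `Finset` form
  have hband : ∀ {n : ℕ} {a : UnitAddTorus d → EuclideanSpace ℝ d}, IsGalerkinMode n a →
      ∀ k ∉ freqBall (d := d) n,
        mFourierCoeff (FunctionSpaces.EuclideanSpace.complexify ∘ a) k = 0 :=
    fun ha k hk => ha.mFourierCoeff_eq_zero (not_mem_freqBall.1 hk)
  exact
    { tendsto_order := tendsto_id
      smooth_force := fun n => contDiff_stLift_realTrigPoly (hg_smooth n)
      tendsto_force := hg_tend
      continuousOn := fun n => continuousOn_stLift_realTrigPoly (hαcont n)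
      isGalerkinMode := fun n t _ =>
        have h := galerkin_slice_props (hS n) (hαmem n t)
        ⟨h.1, h.2.1, fun k hk => h.2.2.2 k (not_mem_freqBall.2 hk)⟩
      isWeaklyDivFree := fun n t _ => (galerkin_slice_props (hS n) (hαmem n t)).2.2.1
      galerkin := fun n a ha s t hs hst =>
        galerkin_test_identity ν (hS n) (hg_cont n) (hg_real n) (hαmem n) (hαderiv n)
          ha.isSmooth ha.isDivFree (hband ha) hs hst
      energy_eq := fun n s t hs hst =>
        galerkin_energy_identity ν (hS n) (hg_cont n) (hg_real n) (hαmem n) (hαderiv n) hs hst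
      initial_inner := fun n a ha => by
        rw [hU0 n]
        exact integral_inner_fourierTruncate_eq hu₀ (ha.isSmooth.memLp 2) (hband ha)
      tendsto_initial := by
        have heq : (fun n => eLpNorm (realTrigPoly (freqBall n) (coeffExt (freqBall n) (α n 0)) -
            u₀) 2 volume) = fun n => eLpNorm (fourierTruncate n u₀ - u₀) 2 volume := by
          funext n; rw [hU0 n]
        rw [heq]
        exact tendsto_eLpNorm_fourierTruncate_sub hu₀ }

end Coeffs

/-! ### Young's inequality for the force term, one Fourier mode -/

section Young

omit [DecidableEq d] in
/-- **Young's inequality for one mode of the force term of the enstrophy identity**: for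
`ν > 0`, `q ≥ 0` (the squared frequency `|k|²`) and vectors `a` (a force coefficient), `b`
(a velocity coefficient),
`Re⟪a, (4π²q) b⟫ ≤ ½ν⁻¹‖a‖² + ½ν · 16π⁴ q² ‖b‖²` — i.e. `(f, Au) ≤ ½ν⁻¹|f|² + ½ν|Au|²`
coefficientwise (Foias–Manley–Rosa–Temam 2001, App. II.A, between (A.65) and (A.66)). [folklore] -/
theorem re_inner_smul_le_young {ν : ℝ} (hν : 0 < ν) {q : ℝ} (hq : 0 ≤ q)
    (a b : EuclideanSpace ℂ d) :
    (inner ℂ a ((((4 * Real.pi ^ 2 * q : ℝ) : ℂ)) • b)).re ≤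
      2⁻¹ * ν⁻¹ * ‖a‖ ^ 2 + 2⁻¹ * ν * (16 * Real.pi ^ 4 * (q ^ 2 * ‖b‖ ^ 2)) := by
  have hν0 : ν ≠ 0 := hν.ne'
  have h1 : (inner ℂ a ((((4 * Real.pi ^ 2 * q : ℝ) : ℂ)) • b)).re ≤
      ‖a‖ * ‖(((4 * Real.pi ^ 2 * q : ℝ) : ℂ)) • b‖ := by
    have h := re_inner_le_norm (𝕜 := ℂ) a ((((4 * Real.pi ^ 2 * q : ℝ) : ℂ)) • b)
    simpa only [RCLike.re_to_complex] using h
  have h2 : ‖(((4 * Real.pi ^ 2 * q : ℝ) : ℂ)) • b‖ = 4 * Real.pi ^ 2 * q * ‖b‖ := by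
    rw [norm_smul, Complex.norm_real, Real.norm_of_nonneg (by positivity)]
  rw [h2] at h1
  have h3 : ‖a‖ * (4 * Real.pi ^ 2 * q * ‖b‖) ≤
      2⁻¹ * ν⁻¹ * ‖a‖ ^ 2 + 2⁻¹ * ν * (4 * Real.pi ^ 2 * q * ‖b‖) ^ 2 := by
    have key : 2⁻¹ * ν⁻¹ * ‖a‖ ^ 2 + 2⁻¹ * ν * (4 * Real.pi ^ 2 * q * ‖b‖) ^ 2 -
        ‖a‖ * (4 * Real.pi ^ 2 * q * ‖b‖) =
          2⁻¹ * ν⁻¹ * (‖a‖ - ν * (4 * Real.pi ^ 2 * q * ‖b‖)) ^ 2 := by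
      field_simp
      ring
    have hnn : 0 ≤ 2⁻¹ * ν⁻¹ * (‖a‖ - ν * (4 * Real.pi ^ 2 * q * ‖b‖)) ^ 2 := by positivity
    linarith
  have h4 : (4 * Real.pi ^ 2 * q * ‖b‖) ^ 2 = 16 * Real.pi ^ 4 * (q ^ 2 * ‖b‖ ^ 2) := by ring
  rw [h4] at h3
  exact h1.trans h3

end Young

/-! ### Two dimensions: the Galerkin enstrophy inequality -/

section TwoDim

variable {S : Finset (Fin 2 → ℤ)}

/-- **The enstrophy inequality of 2-D Galerkin solutions** (Foias–Manley–Rosa–Temam 2001,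
App. II.A: the enstrophy equation (A.65) `½ d/dt‖u‖² + ν|Au|² = (f, Au)` of the 2-D
space-periodic case "provides us with an estimate for the enstrophy which is similar to that
for the kinetic energy", (A.66)–(A.67), PDF p. 118; here for the Fourier–Galerkin system, where
(A.65) is the exact identity `NS.galerkin_enstrophy_identity_fin_two`). Let `ν > 0`, let `α`
solve the Galerkin ODE of order `S` (symmetric) on every `[0, T]` in the Galerkin phase space of
`𝕋²`, driven by continuous real force coefficients `g`, and put `u(τ) = realTrigPoly S (α τ)`,
`G(τ) = realTrigPoly S (g τ)`. Then for `0 ≤ s ≤ t`, in `[0, ∞]`,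
`‖∇u(t)‖₂² + ν ∫ₛᵗ ‖Δu‖₂² ≤ ‖∇u(s)‖₂² + ν⁻¹ ∫ₛᵗ ∫ ‖G‖²`
(spectral norms `Torus.eGradNormSq`, `eLaplacianNormSq`, lower Lebesgue integrals in time):
the identity integrated on `[s, t]`, the force term bounded mode by mode by Young's inequality
`-(G, Δu) ≤ ½ν⁻¹|G|² + ½ν|Δu|²` (`NS.re_inner_smul_le_young`), and Parseval for `|G|²`. [cite: FoiasManleyRosaTemam2001, App. II.A (A.65)–(A.67)] -/
theorem galerkin_enstrophy_ineq_fin_two {ν : ℝ} (hν : 0 < ν) (hS : ∀ k ∈ S, -k ∈ S)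
    {g : ℝ → ↥S → EuclideanSpace ℂ (Fin 2)} (hg : Continuous g) (hgr : ∀ t, IsRealCoeff (g t))
    {α : ℝ → ↥S → EuclideanSpace ℂ (Fin 2)} (hmem : ∀ t, α t ∈ galerkinSubspace S)
    (hα : ∀ T, ∀ t ∈ Icc 0 T, HasDerivWithinAt α (galerkinRHS S ν (g t) (α t)) (Icc 0 T) t)
    {s t : ℝ} (hs : 0 ≤ s) (hst : s ≤ t) :
    eGradNormSq (realTrigPoly S (coeffExt S (α t))) +
        ENNReal.ofReal ν * ∫⁻ τ in Ioo s t, eLaplacianNormSq (realTrigPoly S (coeffExt S (α τ))) ≤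
      eGradNormSq (realTrigPoly S (coeffExt S (α s))) +
        ENNReal.ofReal ν⁻¹ *
          ∫⁻ τ in Ioo s t, ∫⁻ x, ‖realTrigPoly S (coeffExt S (g τ)) x‖ₑ ^ 2 := by
  -- the integrated enstrophy identity (A.65)
  have hid := galerkin_enstrophy_identity_fin_two ν hS hg hgr hmem hα hs hst
  -- names: palinstrophy, force term, force energy
  obtain ⟨Lap, hLap⟩ : ∃ L : ℝ → ℝ,
      L = fun τ => (eLaplacianNormSq (realTrigPoly S (coeffExt S (α τ)))).toReal := ⟨_, rfl⟩
  obtain ⟨P, hP⟩ : ∃ P : ℝ → ℝ, P = fun τ => ∫ x, ⟪realTrigPoly S (coeffExt S (g τ)) x,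
      laplacian (realTrigPoly S (coeffExt S (α τ))) x⟫_ℝ := ⟨_, rfl⟩
  obtain ⟨W, hW⟩ : ∃ W : ℝ → ℝ, W = fun τ => ∑ k : ↥S, ‖g τ k‖ ^ 2 := ⟨_, rfl⟩
  have hα_cont : ContinuousOn α (Icc 0 t) := fun τ hτ => (hα t τ hτ).continuousWithinAt
  -- the palinstrophy and the force term on the Fourier side; continuity
  have hLap_eq : ∀ τ, Lap τ = 16 * Real.pi ^ 4 *
      ∑ k : ↥S, freqNormSq (k : Fin 2 → ℤ) ^ 2 * ‖α τ k‖ ^ 2 := by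
    intro τ; subst hLap; exact toReal_eLaplacianNormSq_coeffExt hS (hmem τ).1
  have hLap_nn : ∀ τ, 0 ≤ Lap τ := fun τ => by
    rw [hLap_eq]
    exact mul_nonneg (by positivity) (Finset.sum_nonneg fun k _ =>
      mul_nonneg (sq_nonneg _) (sq_nonneg _))
  have hLap_cont : ContinuousOn Lap (Icc 0 t) := by
    rw [funext hLap_eq]
    refine continuousOn_const.mul (continuousOn_finsetSum _ fun k _ => ?_)
    exact continuousOn_const.mul (((continuous_apply k).comp_continuousOn hα_cont).norm.pow 2)
  have hP_eq : ∀ τ, P τ = ∑ k : ↥S, (inner ℂ (g τ k)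
      (-(((4 * Real.pi ^ 2 * freqNormSq (k : Fin 2 → ℤ) : ℝ) : ℂ) • α τ k))).re := by
    intro τ
    subst hP
    exact integral_inner_realTrigPoly_laplacian_eq_sum hS (hgr τ) (hmem τ).1
  have hP_cont : ContinuousOn P (Icc 0 t) := by
    rw [funext hP_eq]
    refine continuousOn_finsetSum _ fun k _ => Complex.continuous_re.comp_continuousOn ?_
    refine ((continuous_apply k).comp_continuousOn (hg.continuousOn (s := Icc 0 t))).inner ?_
    exact (((continuous_apply k).comp_continuousOn hα_cont).const_smul
      (((4 * Real.pi ^ 2 * freqNormSq (k : Fin 2 → ℤ) : ℝ) : ℂ))).neg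
  have hW_eq : ∀ τ, W τ = ∑ k : ↥S, ‖g τ k‖ ^ 2 := fun τ => by rw [hW]
  have hW_nn : ∀ τ, 0 ≤ W τ := fun τ => by
    rw [hW_eq]; exact Finset.sum_nonneg fun k _ => sq_nonneg _
  have hW_cont : Continuous W := by
    rw [hW]
    exact continuous_finsetSum _ fun k _ => ((continuous_apply k).comp hg).norm.pow 2
  -- Young's inequality, pointwise in time
  have hY : ∀ τ, -P τ ≤ 2⁻¹ * ν⁻¹ * W τ + 2⁻¹ * ν * Lap τ := by
    intro τ
    calc -P τ = ∑ k : ↥S, (inner ℂ (g τ k)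
          ((((4 * Real.pi ^ 2 * freqNormSq (k : Fin 2 → ℤ) : ℝ) : ℂ)) • α τ k)).re := by
            rw [hP_eq, ← Finset.sum_neg_distrib]
            refine Finset.sum_congr rfl fun k _ => ?_
            rw [inner_neg_right, Complex.neg_re, neg_neg]
      _ ≤ ∑ k : ↥S, (2⁻¹ * ν⁻¹ * ‖g τ k‖ ^ 2 +
            2⁻¹ * ν * (16 * Real.pi ^ 4 * (freqNormSq (k : Fin 2 → ℤ) ^ 2 * ‖α τ k‖ ^ 2))) :=
            Finset.sum_le_sum fun k _ =>
              re_inner_smul_le_young hν (freqNormSq_nonneg _) (g τ k) (α τ k)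
      _ = 2⁻¹ * ν⁻¹ * W τ + 2⁻¹ * ν * Lap τ := by
            rw [Finset.sum_add_distrib, ← Finset.mul_sum, ← Finset.mul_sum, ← Finset.mul_sum,
              hW_eq, hLap_eq]
  -- integrate Young's inequality over `[s, t]`
  have hsub : Icc s t ⊆ Icc 0 t := Icc_subset_Icc hs le_rfl
  have hLap_int : IntervalIntegrable Lap volume s t :=
    (hLap_cont.mono (by rw [uIcc_of_le hst]; exact hsub)).intervalIntegrable
  have hP_int : IntervalIntegrable P volume s t :=
    (hP_cont.mono (by rw [uIcc_of_le hst]; exact hsub)).intervalIntegrable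
  have hW_int : IntervalIntegrable W volume s t := hW_cont.intervalIntegrable _ _
  have hYint : -∫ τ in s..t, P τ ≤
      2⁻¹ * ν⁻¹ * (∫ τ in s..t, W τ) + 2⁻¹ * ν * ∫ τ in s..t, Lap τ := by
    rw [← intervalIntegral.integral_neg, ← intervalIntegral.integral_const_mul,
      ← intervalIntegral.integral_const_mul,
      ← intervalIntegral.integral_add (hW_int.const_mul _) (hLap_int.const_mul _)]
    exact intervalIntegral.integral_mono_on hst hP_int.neg
      ((hW_int.const_mul _).add (hLap_int.const_mul _)) fun τ _ => hY τ
  -- the palinstrophy integral as a `lintegral`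
  have hDfin : ∫⁻ τ in Ioo s t, eLaplacianNormSq (realTrigPoly S (coeffExt S (α τ))) < ⊤ :=
    lintegral_eLaplacianNormSq_galerkin_lt_top hS hmem hα_cont hs
  have hlint : (∫⁻ τ in Ioo s t, eLaplacianNormSq (realTrigPoly S (coeffExt S (α τ)))).toReal =
      ∫ τ in s..t, Lap τ := by
    have heq : ∀ τ, eLaplacianNormSq (realTrigPoly S (coeffExt S (α τ))) =
        ENNReal.ofReal (Lap τ) := by
      intro τ
      rw [hLap_eq, eLaplacianNormSq_coeffExt hS (hmem τ).1]
    simp_rw [heq]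
    have hint : IntegrableOn Lap (Ioo s t) volume :=
      ((hLap_cont.mono hsub).integrableOn_compact isCompact_Icc).mono_set Ioo_subset_Icc_self
    have hnn : 0 ≤ᵐ[volume.restrict (Ioo s t)] Lap := ae_of_all _ hLap_nn
    rw [← ofReal_integral_eq_lintegral_ofReal hint hnn, ENNReal.toReal_ofReal
      (integral_nonneg hLap_nn), intervalIntegral.integral_of_le hst, integral_Ioc_eq_integral_Ioo]
  -- the force energy as a `lintegral`
  have hGlift : ContinuousOn (stLift fun τ => realTrigPoly S (coeffExt S (g τ))) (Ici 0 ×ˢ univ) :=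
    continuousOn_stLift_realTrigPoly hg.continuousOn
  obtain ⟨hFfin, hFeq⟩ := intervalIntegral_norm_sq_eq_toReal hGlift hs hst
  have hWint : ∫ τ in s..t, W τ =
      (∫⁻ τ in Ioo s t, ∫⁻ x, ‖realTrigPoly S (coeffExt S (g τ)) x‖ₑ ^ 2).toReal := by
    rw [← hFeq]
    refine intervalIntegral.integral_congr fun τ _ => ?_
    rw [hW_eq, integral_norm_sq_realTrigPoly hS ((hgr τ).isConjSymm_coeffExt hS),
      sum_coeffExt (fun _ v => ‖v‖ ^ 2)]
  have hWint_nn : 0 ≤ ∫ τ in s..t, W τ :=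
    intervalIntegral.integral_nonneg hst fun τ _ => hW_nn τ
  -- the force integral of the identity is `∫ P`
  have hPint_eq : ∫ τ in s..t, ∫ x, ⟪realTrigPoly S (coeffExt S (g τ)) x,
      laplacian (realTrigPoly S (coeffExt S (α τ))) x⟫_ℝ = ∫ τ in s..t, P τ := by rw [hP]
  rw [hPint_eq, hlint] at hid
  -- the real inequality `E(t) + ν∫Lap ≤ E(s) + ν⁻¹∫W`
  have hEt_nn : 0 ≤ (eGradNormSq (realTrigPoly S (coeffExt S (α t)))).toReal :=
    ENNReal.toReal_nonneg
  have hEs_nn : 0 ≤ (eGradNormSq (realTrigPoly S (coeffExt S (α s)))).toReal :=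
    ENNReal.toReal_nonneg
  have hD_nn : 0 ≤ ∫ τ in s..t, Lap τ := intervalIntegral.integral_nonneg hst fun τ _ => hLap_nn τ
  have hreal : (eGradNormSq (realTrigPoly S (coeffExt S (α t)))).toReal + ν * ∫ τ in s..t, Lap τ ≤
      (eGradNormSq (realTrigPoly S (coeffExt S (α s)))).toReal + ν⁻¹ * ∫ τ in s..t, W τ := by
    nlinarith [hid, hYint, hν]
  -- back to `ℝ≥0∞`
  have hEt : eGradNormSq (realTrigPoly S (coeffExt S (α t))) =
      ENNReal.ofReal (eGradNormSq (realTrigPoly S (coeffExt S (α t)))).toReal := by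
    rw [eGradNormSq_coeffExt hS (hmem t).1, ENNReal.toReal_ofReal]
    exact mul_nonneg (by positivity) (Finset.sum_nonneg fun k _ =>
      mul_nonneg (freqNormSq_nonneg _) (sq_nonneg _))
  have hEs : eGradNormSq (realTrigPoly S (coeffExt S (α s))) =
      ENNReal.ofReal (eGradNormSq (realTrigPoly S (coeffExt S (α s)))).toReal := by
    rw [eGradNormSq_coeffExt hS (hmem s).1, ENNReal.toReal_ofReal]
    exact mul_nonneg (by positivity) (Finset.sum_nonneg fun k _ =>
      mul_nonneg (freqNormSq_nonneg _) (sq_nonneg _))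
  rw [hEt, hEs, ← ENNReal.ofReal_toReal hDfin.ne, ← ENNReal.ofReal_toReal hFfin.ne, hlint,
    ← hWint, ← ENNReal.ofReal_mul hν.le, ← ENNReal.ofReal_mul (inv_nonneg.2 hν.le),
    ← ENNReal.ofReal_add hEt_nn (mul_nonneg hν.le hD_nn),
    ← ENNReal.ofReal_add hEs_nn (mul_nonneg (inv_nonneg.2 hν.le) hWint_nn)]
  exact ENNReal.ofReal_le_ofReal hreal

/-- **A Hopf–Galerkin scheme on `𝕋²` with the enstrophy inequality** (Foias–Manley–Rosa–Temam
2001, Ch. II Thm. 7.4 with Remark 7.1 and App. II.A (A.65)–(A.67): the a priori enstrophy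
estimate of the Galerkin approximations in the 2-D space-periodic case; Robinson–Rodrigo–Sadowski
2016, Thm. 4.4 Steps 1–2 for the scheme). Let `ν > 0`, let `u₀ ∈ L²(𝕋²)` be weakly divergence
free and let `f` be space–time measurable with `∫₀ᵀ∫‖f‖² < ∞` for every `T > 0`. Then there is a
Hopf–Galerkin scheme `(N, F, U)` for `(ν, f, u₀)` (`NS.IsHopfGalerkinScheme`) such that
`‖∇U n(0)‖₂² ≤ ‖∇u₀‖₂²` for every `n` (`U n 0 = P_n u₀`), and for all `n` and `0 ≤ s ≤ t`,
`‖∇U n(t)‖₂² + ν∫ₛᵗ‖ΔU n‖₂² ≤ ‖∇U n(s)‖₂² + ν⁻¹∫ₛᵗ∫‖F n‖²` in `[0, ∞]`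
(`NS.galerkin_enstrophy_ineq_fin_two` along `NS.exists_hopfGalerkinScheme_coeffs`). [cite: FoiasManleyRosaTemam2001, Ch. II Thm. 7.4, App. II.A (A.65)–(A.67)] -/
theorem exists_hopfGalerkinScheme_enstrophy_fin_two (ν : ℝ) (hν : 0 < ν)
    (u₀ : UnitAddTorus (Fin 2) → EuclideanSpace ℝ (Fin 2)) (hu₀ : MemLp u₀ 2 volume)
    (hdiv : FunctionSpaces.Torus.IsWeaklyDivFree u₀)
    (f : ℝ → UnitAddTorus (Fin 2) → EuclideanSpace ℝ (Fin 2))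
    (hf : AEStronglyMeasurable (stLift f) (volume.restrict (Ioi 0 ×ˢ univ)))
    (hf₂ : ∀ T, 0 < T → ∫⁻ t in Ioo 0 T, ∫⁻ x, ‖f t x‖ₑ ^ 2 < ⊤) :
    ∃ (N : ℕ → ℕ) (F U : ℕ → ℝ → UnitAddTorus (Fin 2) → EuclideanSpace ℝ (Fin 2)),
      IsHopfGalerkinScheme ν f u₀ N F U ∧
      (∀ n, eGradNormSq (U n 0) ≤ eGradNormSq u₀) ∧
      ∀ n s t, 0 ≤ s → s ≤ t →
        eGradNormSq (U n t) + ENNReal.ofReal ν * ∫⁻ τ in Ioo s t, eLaplacianNormSq (U n τ) ≤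
          eGradNormSq (U n s) + ENNReal.ofReal ν⁻¹ * ∫⁻ τ in Ioo s t, ∫⁻ x, ‖F n τ x‖ₑ ^ 2 := by
  obtain ⟨g, α, hg, hgr, hα0, hαmem, -, hαderiv, hGS⟩ :=
    exists_hopfGalerkinScheme_coeffs ν hν u₀ hu₀ hdiv f hf hf₂
  refine ⟨id, _, _, hGS, fun n => ?_, fun n s t hs hst => ?_⟩
  · have hU0 : realTrigPoly (freqBall n) (coeffExt (freqBall n) (α n 0)) = fourierTruncate n u₀ := by
      rw [hα0 n, fourierTruncate_eq]
      exact realTrigPoly_coeffExt_restrict _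
    show eGradNormSq (realTrigPoly (freqBall n) (coeffExt (freqBall n) (α n 0))) ≤ _
    rw [hU0]
    exact eGradNormSq_fourierTruncate_le (hu₀.integrable one_le_two) n
  · exact galerkin_enstrophy_ineq_fin_two hν neg_mem_freqBall_of_mem (hg n) (hgr n) (hαmem n)
      (hαderiv n) hs hst

end TwoDim

end NS

end Literature.Analysis.FluidPDE

end
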